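import Mathlib
import Literature.NumberTheory.LFunctions.Zhang2022.SkeletonLemma83Rel
import Literature.NumberTheory.LFunctions.Zhang2022.SkeletonAlpha1
import HarnessLib

/-!
# Zhang (2022), typed skeleton XVIII: Lemma 8.4 in the RELATIVE form, and the proof nodes of
# §§8–10, 12 that consume Lemmas 8.3–8.4 re-pointed to the relative forms

Topic `Literature/NumberTheory/LFunctions/Zhang2022` (Landau–Siegel audit tree; verdict-neutral).
Y. Zhang, *Discrete mean estimates and the Landau–Siegel zero*, arXiv:2211.02515v1 (2022)
[Zhang2022LandauSiegel] — **an unrefereed manuscript under adjudication; every `def … : Prop`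
below is a CLAIM NODE, STATED NOT ASSERTED** (a named hypothesis of the whole-DAG theorem).

Why this file exists (campaign D-0069; TEAM A row G-adj1-1 and sz-d21's GAPCAND of 2026-08-26,
same root as G-d55-3): Lemma 8.4 (§8 p. 47, "`… = L′(1,χ)Π(d,r)𝔤_{jμ}(x) + O(𝓛⁻⁶)`") with an
ABSOLUTE `O(𝓛⁻⁶)` is not delivered by its printed proof: the `|s| = 5α` circle term of the contour
argument carries a factor `|Π(d,r)|`, and `sup_{dr<PT⁻²}|Π(d,r)|` is unbounded (primes `q ≤ D⁴` with
`χ(q) = 1` are uncontrolled; Lemma 3.1 starts at `D⁴`). The derivable statement multiplies the error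
by `∏_{q∣dr}(1 − q⁻¹)⁻²`. This file banks that RELATIVE form `Lemma84Rel c′` (the banked `Lemma84`
verbatim except for the factor), the comparison edge from the printed form, and the proof nodes that
CONSUME Lemmas 8.3/8.4 re-pointed to the relative forms `Lemma83Rel` (file `SkeletonLemma83Rel`) and
`Lemma84Rel`: `Ded823Rel`, `Ded97Rel`, `Ded1017Rel`, `Ded1217Rel` (the last also with the `α₁`
reading `Lemma121R` of `SkeletonAlpha1`) — whether the §§8–10, 12 computations survive the relative
errors is exactly what these CLAIM nodes now state and the adjudication decides. The whole-DAG
theorem re-threads through them from version `v8`.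

What is NOT asserted: any of these claims. Nothing here bears on Theorems 1–2 of the source.

## References

* Y. Zhang, arXiv:2211.02515v1 (2022), §8 Lemmas 8.3–8.4 (pp. 46–47, tex L2389–L2419), (8.23),
  §9 (9.7), §10 (10.17), §12 (12.17). [cite: Zhang2022LandauSiegel, §8 Lemma 8.4]
-/

noncomputable section

open Complex Real

namespace Literature.NumberTheory.LFunctions.Zhang2022.Skeleton

variable (c' : ℝ)

/-- **Lemma 8.4, relative form** (§8 p. 47 with the error the printed contour argument delivers):
for `dr < PT⁻²`, `T < x < P`, `μ = 6, 7`, `1 ≤ j ≤ 3`: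
`|Σ_{n<x} χ(n)ξ₀ⱼ(n;d,r)n⁻¹(x/n)^{−β_μ}log(x/n) − L′(1,χ)Π(d,r)𝔤_{jμ}(x)| ≤ C𝓛⁻⁶·∏_{q∣dr}(1 − q⁻¹)⁻²`
— the banked `Lemma84 c′` verbatim except for the factor `∏_{q∣dr}(1 − q⁻¹)⁻²`. CLAIM, stated not
asserted (rows G-adj1-1, G-d55-3). [cite: Zhang2022LandauSiegel, §8 Lemma 8.4] -/
def Lemma84Rel : Prop :=
  ∃ C : ℝ, ForAllLarge fun D _ χ => AssumptionA D χ →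
    ∀ j ∈ ({1, 2, 3} : Finset ℕ), ∀ μ ∈ ({6, 7} : Finset ℕ), ∀ d r : ℕ, 1 ≤ d → 1 ≤ r →
      ((d * r : ℕ) : ℝ) < bigP D / bigT D ^ 2 → ∀ y : ℝ, bigT D < y → y < bigP D →
        ‖(∑ n ∈ Finset.Ico 1 ⌈y⌉₊, χ (n : ZMod D) * xiZero c' D j n d r / (n : ℂ) *
              ((y / n : ℝ) : ℂ) ^ (-betaMu D μ) * (Real.log (y / n) : ℂ)) -
            deriv χ.LFunction 1 * PiW χ d r * frakgW c' D j μ y‖ ≤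
          C * (ell D ^ 6)⁻¹ * (∏ q ∈ (d * r).primeFactors, (1 - (q : ℝ)⁻¹)⁻¹) ^ 2

/-- **(8.9)–(8.23) from the relative Lemmas 8.3–8.4** (the banked `Ded823` re-pointed). CLAIM.
[cite: Zhang2022LandauSiegel, §8 (8.9)–(8.23)] -/
def Ded823Rel : Prop :=
  Eq87 c' → Prop71 c' → Lemma82 c' → Lemma83Rel c' → Lemma84Rel c' → Eval823 c'

/-- **(9.1)–(9.7) from the relative Lemmas 8.3–8.4** (the banked `Ded97` re-pointed). CLAIM.
[cite: Zhang2022LandauSiegel, §9 (9.1)–(9.7)] -/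
def Ded97Rel : Prop :=
  Eq91 c' → Prop71 c' → Lemma82 c' → Lemma83Rel c' → Lemma84Rel c' → Eval97 c'

/-- **(10.12)–(10.17) from the relative Lemmas 8.3–8.4** (the banked `Ded1017` re-pointed). CLAIM.
[cite: Zhang2022LandauSiegel, §10 (10.12)–(10.17)] -/
def Ded1017Rel : Prop :=
  Eq101 c' → Prop71 c' → Lemma82 c' → Lemma83Rel c' → Lemma84Rel c' → Lemma101 c' →
    Lemma102 c' → Eval1017 c'

/-- **(12.6)–(12.17) from the relative Lemmas 8.3–8.4 and Lemma 12.1 in the `α₁` reading** (the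
banked `Ded1217` / `Ded1217R` re-pointed). CLAIM. [cite: Zhang2022LandauSiegel, §12 (12.6)–(12.17)] -/
def Ded1217Rel : Prop :=
  Prop71 c' → Lemma81 c' → Lemma82 c' → Lemma83Rel c' → Lemma84Rel c' → Lemma58 → Lemma121R c' →
    Lemma123 c' → Eval1217 c'

/-! ## Comparison edges -/

/-- The printed (absolute) Lemma 8.4 implies the relative form (`∏_{q∣dr}(1 − q⁻¹)⁻² ≥ 1`).
[cite: Zhang2022LandauSiegel, §8 Lemma 8.4] -/
theorem lemma84Rel_of_lemma84 {c' : ℝ} (h : Lemma84 c') : Lemma84Rel c' := by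
  obtain ⟨C, hC⟩ := h
  refine ⟨|C|, hC.mono fun D _ χ _ _ hS hA j hj μ hμ d r hd hr hdr y hy1 hy2 => ?_⟩
  have hprod : 1 ≤ ∏ q ∈ (d * r).primeFactors, (1 - (q : ℝ)⁻¹)⁻¹ := by
    refine le_of_eq_of_le (Finset.prod_const_one (s := (d * r).primeFactors)).symm
      (Finset.prod_le_prod (fun _ _ => zero_le_one) fun q hq => ?_)
    have hq2 : (2 : ℝ) ≤ q := by exact_mod_cast (Nat.prime_of_mem_primeFactors hq).two_le
    have h1 : 0 < 1 - (q : ℝ)⁻¹ := by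
      have : (q : ℝ)⁻¹ ≤ 1 / 2 := by rw [inv_eq_one_div]; gcongr
      linarith
    have h2 : 1 - (q : ℝ)⁻¹ ≤ 1 := by
      have : 0 ≤ (q : ℝ)⁻¹ := by positivity
      linarith
    exact (one_le_inv₀ h1).mpr h2
  have hℓ : 0 ≤ (ell D ^ 6)⁻¹ := by positivity
  calc _ ≤ C * (ell D ^ 6)⁻¹ := hS hA j hj μ hμ d r hd hr hdr y hy1 hy2
    _ ≤ |C| * (ell D ^ 6)⁻¹ := by gcongr; exact le_abs_self _
    _ = |C| * (ell D ^ 6)⁻¹ * 1 ^ 2 := by ring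
    _ ≤ |C| * (ell D ^ 6)⁻¹ * (∏ q ∈ (d * r).primeFactors, (1 - (q : ℝ)⁻¹)⁻¹) ^ 2 := by
        gcongr

/-- `Ded823Rel` (from the weaker relative inputs) implies the banked `Ded823`.
[cite: Zhang2022LandauSiegel, §8 (8.23)] -/
theorem ded823_of_ded823Rel {c' : ℝ} (h : Ded823Rel c') : Ded823 c' :=
  fun h87 h71 h82 h83 h84 => h h87 h71 h82 (lemma83Rel_of_lemma83 h83) (lemma84Rel_of_lemma84 h84)

/-- `Ded97Rel` implies the banked `Ded97`. [cite: Zhang2022LandauSiegel, §9 (9.7)] -/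
theorem ded97_of_ded97Rel {c' : ℝ} (h : Ded97Rel c') : Ded97 c' :=
  fun h91 h71 h82 h83 h84 => h h91 h71 h82 (lemma83Rel_of_lemma83 h83) (lemma84Rel_of_lemma84 h84)

/-- `Ded1017Rel` implies the banked `Ded1017`. [cite: Zhang2022LandauSiegel, §10 (10.17)] -/
theorem ded1017_of_ded1017Rel {c' : ℝ} (h : Ded1017Rel c') : Ded1017 c' :=
  fun h101 h71 h82 h83 h84 hL1 hL2 =>
    h h101 h71 h82 (lemma83Rel_of_lemma83 h83) (lemma84Rel_of_lemma84 h84) hL1 hL2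

/-- `Ded1217Rel` implies `Ded1217R` (and hence the banked `Ded1217`, `ded1217_of_ded1217R`).
[cite: Zhang2022LandauSiegel, §12 (12.17)] -/
theorem ded1217R_of_ded1217Rel {c' : ℝ} (h : Ded1217Rel c') : Ded1217R c' :=
  fun h71 h81 h82 h83 h84 h58 h121 h123 =>
    h h71 h81 h82 (lemma83Rel_of_lemma83 h83) (lemma84Rel_of_lemma84 h84) h58 h121 h123

end Literature.NumberTheory.LFunctions.Zhang2022.Skeleton
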